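import Literature.ComputerArithmetic.Higham2002.Gamma

/-!
# Rounding error of recursive summation and of the inner product (Higham §3.1, §4.2)

HONEST FRAMING (venture CertifiedArithmetic / cell `pub-lowprec`): certified error envelopes and
provably optimal rounding/accumulation schemes for low-precision formats under stated cost models;
every table by two implementations; no hardware or vendor claims.

Typed and PROVED from [Higham2002ASNA, §4.2 eqs. (4.2)–(4.4) and §3.1 eq. (3.5)] in MODEL form:
recursive summation `ŝ₀ = x₀`, `ŝₖ₊₁ = (ŝₖ + xₖ₊₁)(1 + δₖ₊₁)` with `|δₖ| ≤ u` satisfies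
`|ŝₙ - Σ_{i ≤ n} xᵢ| ≤ ((1+u)ⁿ - 1) Σ |xᵢ| ≤ γₙ Σ |xᵢ|` (`n` additions of `n + 1` terms — Higham's
`γ_{n-1}` for `n` terms), and the recursively accumulated inner product with products
`pᵢ = aᵢ bᵢ (1 + εᵢ)`, `|εᵢ| ≤ u`, satisfies `|ŝ - Σ aᵢbᵢ| ≤ ((1+u)ⁿ - 1) Σ |aᵢ bᵢ| ≤ γₙ Σ |aᵢ bᵢ|`
for `n` terms. The standard model `fl(a ∘ b) = (a ∘ b)(1 + δ)`, `|δ| ≤ u` that feeds these `δ`'s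
is discharged for concrete formats elsewhere (the venture's `ErrorTables.lean`); here the `δ`'s
are hypotheses, exactly as in the source. Ordered field `K` arbitrary.
-/

namespace Literature.ComputerArithmetic.Higham2002

open Finset

variable {K : Type*} [Field K] [LinearOrder K] [IsStrictOrderedRing K]

/-- Recursive summation in the rounding-error MODEL: `ŝ₀ = x₀`, `ŝₖ₊₁ = (ŝₖ + xₖ₊₁)(1 + δₖ₊₁)`.
[cite: Higham2002ASNA, §4.2 eq. (4.2)] -/
def recSum (x δ : ℕ → K) : ℕ → K
  | 0 => x 0
  | k + 1 => (recSum x δ k + x (k + 1)) * (1 + δ (k + 1))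

/-- `u ≤ (1+u)^(k+1) - 1` for `u ≥ 0`. [cite: Higham2002ASNA, Lemma 3.1] -/
theorem le_one_add_pow_succ_sub_one {u : K} (hu : 0 ≤ u) (k : ℕ) : u ≤ (1 + u) ^ (k + 1) - 1 := by
  have h1 : (1 : K) ≤ (1 + u) ^ k := one_le_pow₀ (by linarith)
  rw [pow_succ]
  nlinarith

/-- RECURSIVE SUMMATION, sharp model bound: `|ŝₙ - Σ_{i≤n} xᵢ| ≤ ((1+u)ⁿ - 1) · Σ_{i≤n} |xᵢ|`.
[cite: Higham2002ASNA, §4.2 eq. (4.3)] -/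
theorem abs_recSum_sub_sum_le {u : K} (hu : 0 ≤ u) (x δ : ℕ → K) (hδ : ∀ k, |δ k| ≤ u) :
    ∀ n : ℕ, |recSum x δ n - ∑ i ∈ range (n + 1), x i|
      ≤ ((1 + u) ^ n - 1) * ∑ i ∈ range (n + 1), |x i|
  | 0 => by simp [recSum]
  | n + 1 => by
      have ih := abs_recSum_sub_sum_le hu x δ hδ n
      set S := ∑ i ∈ range (n + 1), x i with hS
      set A := ∑ i ∈ range (n + 1), |x i| with hA
      have hA0 : 0 ≤ A := Finset.sum_nonneg fun i _ => abs_nonneg _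
      have hSA : |S| ≤ A := Finset.abs_sum_le_sum_abs _ _
      have hd := abs_le.mp (hδ (n + 1))
      have hp : (1 : K) ≤ (1 + u) ^ n := one_le_pow₀ (by linarith)
      rw [Finset.sum_range_succ x (n + 1), Finset.sum_range_succ (fun i => |x i|) (n + 1), ← hS, ← hA]
      simp only [recSum]
      -- error recursion: e' = e (1+δ) + δ (S + x')
      have key : recSum x δ n * (1 + δ (n + 1)) + x (n + 1) * (1 + δ (n + 1)) - (S + x (n + 1))
          = (recSum x δ n - S) * (1 + δ (n + 1)) + δ (n + 1) * (S + x (n + 1)) := by ring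
      rw [show (recSum x δ n + x (n + 1)) * (1 + δ (n + 1))
          = recSum x δ n * (1 + δ (n + 1)) + x (n + 1) * (1 + δ (n + 1)) by ring, key]
      have h1 : |(recSum x δ n - S) * (1 + δ (n + 1))| ≤ ((1 + u) ^ n - 1) * A * (1 + u) := by
        rw [abs_mul]
        apply mul_le_mul ih _ (abs_nonneg _) (by nlinarith)
        rw [abs_le]; constructor <;> linarith
      have h2 : |δ (n + 1) * (S + x (n + 1))| ≤ u * (A + |x (n + 1)|) := by
        rw [abs_mul]
        apply mul_le_mul (hδ _) _ (abs_nonneg _) hu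
        exact le_trans (abs_add_le _ _) (by linarith)
      have hx0 := abs_nonneg (x (n + 1))
      calc |(recSum x δ n - S) * (1 + δ (n + 1)) + δ (n + 1) * (S + x (n + 1))|
          ≤ ((1 + u) ^ n - 1) * A * (1 + u) + u * (A + |x (n + 1)|) :=
            le_trans (abs_add_le _ _) (add_le_add h1 h2)
        _ = ((1 + u) ^ (n + 1) - 1) * A + u * |x (n + 1)| := by ring
        _ ≤ ((1 + u) ^ (n + 1) - 1) * A + ((1 + u) ^ (n + 1) - 1) * |x (n + 1)| := by
            have := le_one_add_pow_succ_sub_one hu n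
            nlinarith
        _ = ((1 + u) ^ (n + 1) - 1) * (A + |x (n + 1)|) := by ring

/-- RECURSIVE SUMMATION, `γ` form: with `nu < 1`, `|ŝₙ - Σ_{i≤n} xᵢ| ≤ γₙ · Σ_{i≤n} |xᵢ|`
(`n` additions; Higham's (4.4) `|Eₙ| ≤ γ_{n-1} Σ |xᵢ|` for `n` summands).
[cite: Higham2002ASNA, §4.2 eq. (4.4)] -/
theorem abs_recSum_sub_sum_le_gamma {u : K} (hu : 0 ≤ u) {n : ℕ} (hn : (n : K) * u < 1)
    (x δ : ℕ → K) (hδ : ∀ k, |δ k| ≤ u) :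
    |recSum x δ n - ∑ i ∈ range (n + 1), x i| ≤ gamma u n * ∑ i ∈ range (n + 1), |x i| :=
  le_trans (abs_recSum_sub_sum_le hu x δ hδ n)
    (mul_le_mul_of_nonneg_right (one_add_pow_sub_one_le_gamma hu hn)
      (Finset.sum_nonneg fun _ _ => abs_nonneg _))

/-- Recursively accumulated inner product in the MODEL: products `pᵢ = aᵢ bᵢ (1 + εᵢ)`, then
`ŝ₀ = p₀`, `ŝₖ₊₁ = (ŝₖ + pₖ₊₁)(1 + δₖ₊₁)`. [cite: Higham2002ASNA, §3.1 eq. (3.2)–(3.3)] -/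
def recDot (a b ε δ : ℕ → K) : ℕ → K
  | 0 => a 0 * b 0 * (1 + ε 0)
  | k + 1 => (recDot a b ε δ k + a (k + 1) * b (k + 1) * (1 + ε (k + 1))) * (1 + δ (k + 1))

/-- INNER PRODUCT, sharp model bound: for `n + 1` terms,
`|ŝₙ - Σ_{i≤n} aᵢbᵢ| ≤ ((1+u)^(n+1) - 1) · Σ_{i≤n} |aᵢ bᵢ|`. [cite: Higham2002ASNA, §3.1 eq. (3.4)] -/
theorem abs_recDot_sub_sum_le {u : K} (hu : 0 ≤ u) (a b ε δ : ℕ → K) (hε : ∀ k, |ε k| ≤ u)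
    (hδ : ∀ k, |δ k| ≤ u) :
    ∀ n : ℕ, |recDot a b ε δ n - ∑ i ∈ range (n + 1), a i * b i|
      ≤ ((1 + u) ^ (n + 1) - 1) * ∑ i ∈ range (n + 1), |a i * b i|
  | 0 => by
      simp only [recDot, zero_add, Finset.range_one, Finset.sum_singleton, pow_one]
      rw [show a 0 * b 0 * (1 + ε 0) - a 0 * b 0 = ε 0 * (a 0 * b 0) by ring, abs_mul]
      rw [show 1 + u - 1 = u by ring]
      exact mul_le_mul_of_nonneg_right (hε 0) (abs_nonneg _)
  | n + 1 => by
      have ih := abs_recDot_sub_sum_le hu a b ε δ hε hδ n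
      set S := ∑ i ∈ range (n + 1), a i * b i with hS
      set A := ∑ i ∈ range (n + 1), |a i * b i| with hA
      set t := a (n + 1) * b (n + 1) with ht
      have hA0 : 0 ≤ A := Finset.sum_nonneg fun i _ => abs_nonneg _
      have hSA : |S| ≤ A := Finset.abs_sum_le_sum_abs _ _
      have hd := abs_le.mp (hδ (n + 1))
      have he := abs_le.mp (hε (n + 1))
      have hp : (1 : K) ≤ (1 + u) ^ (n + 1) := one_le_pow₀ (by linarith)
      rw [Finset.sum_range_succ (fun i => a i * b i) (n + 1),
        Finset.sum_range_succ (fun i => |a i * b i|) (n + 1), ← hS, ← hA, ← ht]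
      simp only [recDot]
      rw [← ht]
      have key : (recDot a b ε δ n + t * (1 + ε (n + 1))) * (1 + δ (n + 1)) - (S + t)
          = (recDot a b ε δ n - S) * (1 + δ (n + 1)) + (ε (n + 1) * t) * (1 + δ (n + 1))
            + δ (n + 1) * (S + t) := by ring
      rw [key]
      have h1 : |(recDot a b ε δ n - S) * (1 + δ (n + 1))| ≤ ((1 + u) ^ (n + 1) - 1) * A * (1 + u) := by
        rw [abs_mul]
        apply mul_le_mul ih _ (abs_nonneg _) (by nlinarith)
        rw [abs_le]; constructor <;> linarith
      have h2 : |ε (n + 1) * t * (1 + δ (n + 1))| ≤ u * |t| * (1 + u) := by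
        rw [abs_mul, abs_mul]
        apply mul_le_mul (mul_le_mul_of_nonneg_right (hε _) (abs_nonneg _)) _ (abs_nonneg _)
          (by positivity)
        rw [abs_le]; constructor <;> linarith
      have h3 : |δ (n + 1) * (S + t)| ≤ u * (A + |t|) := by
        rw [abs_mul]
        apply mul_le_mul (hδ _) _ (abs_nonneg _) hu
        exact le_trans (abs_add_le _ _) (by linarith)
      have ht0 := abs_nonneg t
      calc |(recDot a b ε δ n - S) * (1 + δ (n + 1)) + ε (n + 1) * t * (1 + δ (n + 1))
              + δ (n + 1) * (S + t)|
          ≤ ((1 + u) ^ (n + 1) - 1) * A * (1 + u) + u * |t| * (1 + u) + u * (A + |t|) := by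
            refine le_trans (abs_add_le _ _) (add_le_add (le_trans (abs_add_le _ _) (add_le_add h1 h2)) h3)
        _ = ((1 + u) ^ (n + 2) - 1) * A + ((1 + u) ^ 2 - 1) * |t| := by ring
        _ ≤ ((1 + u) ^ (n + 2) - 1) * A + ((1 + u) ^ (n + 2) - 1) * |t| := by
            have : (1 + u) ^ 2 ≤ (1 + u) ^ (n + 2) :=
              pow_le_pow_right₀ (by linarith) (by omega)
            nlinarith
        _ = ((1 + u) ^ (n + 1 + 1) - 1) * (A + |t|) := by ring

/-- INNER PRODUCT, `γ` form: for `n + 1` terms with `(n+1)u < 1`,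
`|fl(aᵀb) - aᵀb| ≤ γ_{n+1} · Σ |aᵢ bᵢ|` — Higham's `|xᵀy - fl(xᵀy)| ≤ γₙ |x|ᵀ|y|` for `n` terms.
[cite: Higham2002ASNA, §3.1 eq. (3.5)] -/
theorem abs_recDot_sub_sum_le_gamma {u : K} (hu : 0 ≤ u) {n : ℕ} (hn : ((n + 1 : ℕ) : K) * u < 1)
    (a b ε δ : ℕ → K) (hε : ∀ k, |ε k| ≤ u) (hδ : ∀ k, |δ k| ≤ u) :
    |recDot a b ε δ n - ∑ i ∈ range (n + 1), a i * b i|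
      ≤ gamma u (n + 1) * ∑ i ∈ range (n + 1), |a i * b i| :=
  le_trans (abs_recDot_sub_sum_le hu a b ε δ hε hδ n)
    (mul_le_mul_of_nonneg_right (one_add_pow_sub_one_le_gamma hu hn)
      (Finset.sum_nonneg fun _ _ => abs_nonneg _))

end Literature.ComputerArithmetic.Higham2002
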